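import Literature.NumberTheory.EllipticCurves.OpenImageMazurAssemblyProofs
import HarnessLib

/-!
# Mazur's isogeny theorem (`mazur_isogeny_irreducible`): its two remaining printed inputs as
# named facts — Cor. 4.4 (the Eisenstein quotient) and Prop. 5.1 (the classes of `k`)

Topic `Literature/NumberTheory/EllipticCurves`; companion of `OpenImage.lean` and
`OpenImageMazurAssemblyProofs.lean` (B. Mazur, *Rational isogenies of prime degree*, Invent. Math.
44 (1978) 129–162, Thm. 1). Librarian fact decomposition (`fact-decompose`, human 2026-08-16) of
the budget-capped named fact `Literature.NumberTheory.EllipticCurves.mazur_isogeny_irreducible`.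

`OpenImageMazurAssemblyProofs` proves Thm. 1 from exactly the two inputs of Mazur's printed proof
that are not formalised (`Mazur1978.mazur_isogeny_irreducible_of_inputs`), each displayed there as
a hypothesis. This file records those two printed intermediate results as named facts, verbatim in
the shape consumed by that theorem, and the PROVED assembly:

* `Mazur1978.cor44_valuation_j_le_one` — **Cor. 4.4** (p. 145): an elliptic curve over `ℚ` with a
  `ℚ`-rational `N`-isogeny, `N = 11` or `N ≥ 17` prime, has potentially good reduction at every
  odd prime, i.e. `ord_v(j(E)) ≥ 0` at every finite place `v ∌ 2` — the arithmetic of the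
  Eisenstein quotient `J̃` of `J₀(N)` (finiteness of `J̃(ℚ)`, Mazur 1977, III.3.1; formal immersion
  at `∞`, Prop. 3.1; Cor. 4.3);
* `Mazur1978.prop51_exponent_classes_of_additive` — **Prop. 5.1, the classes of `k`, at a prime
  `N` of additive (potentially good) reduction** (pp. 150–151; Raynaud's theorem on group schemes
  of type `(p, …, p)` over a base of ramification index `e ≤ 6 < N − 1`): given the normal form
  `r = α·χ̄ᵏ⁰`, `α¹² = 1`, of the isogeny character with Lemma 5.2's exponent `k₀`, there is `k`
  with `k ≡ 0, 1, 1/2, 1/3` or `2/3 (mod (N−1)/2)` and `r = α'·χ̄ᵏ`, `α'¹² = 1` (the case of good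
  reduction at `N` is PROVED: `modEq_zero_or_one_of_hasGoodReductionAtPrime`);
* `mazur_isogeny_irreducible_holds_of` — **Cor. 4.4 → Prop. 5.1-classes → Thm. 1**, which is
  `Mazur1978.mazur_isogeny_irreducible_of_inputs` (everything else of §§5–7 is proved in the tree,
  see the module docstring of `OpenImageMazurAssemblyProofs`).

Neither child restates the parent: Cor. 4.4 is an integrality statement for `j`, Prop. 5.1 a
statement about characters of `Gal(ℚ̄/ℚ)`; Thm. 1 is the irreducibility of `E[p]`.

## References

* [Mazur1978] B. Mazur, *Rational isogenies of prime degree*, Invent. Math. 44 (1978) 129–162: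
  Thm. 1 (pp. 129–130), Prop. 3.1, Cor. 4.3, Cor. 4.4 (p. 145), §5 Prop. 5.1, Lemma 5.2
  (pp. 148–151), §7 (pp. 154–155).
* B. Mazur, *Modular curves and the Eisenstein ideal*, Publ. Math. IHÉS 47 (1977), III.3.1.
* M. Raynaud, *Schémas en groupes de type (p, …, p)*, Bull. SMF 102 (1974) 241–280, Cor. 3.4.4.
-/

noncomputable section

open scoped Classical
open NumberField IsDedekindDomain IsDedekindDomain.HeightOneSpectrum Field WeierstrassCurve
  Literature.NumberTheory.GaloisRepresentations

universe u

namespace Literature.NumberTheory.EllipticCurves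

namespace Mazur1978

/-- **Mazur 1978, Cor. 4.4** (p. 145, verbatim: "From this point on, `N` will designate a rational
*prime* number. **Corollary 4.4.** Let `K = ℚ`, and `N = 11` or `N =` a prime number `≥ 17`. Then
any elliptic curve over `ℚ` which possesses a `ℚ`-rational `N`-isogeny has potentially good
reduction at all primes `p ≠ 2`. *Proof.* Apply Corollary 4.3 with `A = J̃`, the Eisenstein
quotient of `J₀(N)` which has finite Mordell-Weil group by ([19] III 3.1)." — so printed, with NO
clause at `p = 2`: Cor. 4.3 (p. 144) covers exactly the primes `𝔭` of `K` of characteristic `p`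
with `e_𝔭(K/ℚ) < p − 1`, i.e. `p ≠ 2` over `ℚ`; an earlier bracket of this docstring, «and at
`p = 2` if `N ≡ 1 mod 8`», stands on neither page and is WITHDRAWN (ARM P reader r03 Q28
`D-AUDIT-r03-Q28-Mazur7778.md` 9239ed87fb3a891f N-r03-Q28-1, page images
`sheets/r03-texts/maz78-gdz/p_phys153.jpg` = p. 145 and GDZ PHYS 152 = p. 144; desk C2 ROUND 519;
DD-119). Mechanism: Cor. 4.3 — a rational point of `X₀(N)` other than the cusps specialises to a
cusp at no such `𝔭` — via the Eisenstein quotient `J̃` of `J₀(N)`: `J̃(ℚ)` finite (Mazur 1977,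
III.3.1) and the formal immersion `X₀(N) → J̃` at `∞` (Prop. 3.1).) Rendered for a
Weierstrass model `W` of `E/ℚ` and a prime `N` with `N = 11 ∨ 17 ≤ N`: if `E[N]` has a
`Gal(ℚ̄/ℚ)`-stable subgroup of order `N` (a rational `N`-isogeny), then `ord_v(j(E)) ≥ 0`, i.e.
`v(j) ≤ 1` multiplicatively (`HeightOneSpectrum.valuation`), at every finite place `v` of `ℚ` not
containing `2` (potentially good reduction ⟺ `j` integral at `v`, Silverman *AEC* VII.5.5).
Nothing is recorded at `p = 2` (the print asserts nothing there, and nothing at `2` is used in the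
proof of Thm. 1). This is the hypothesis `hCor44` of `mazur_isogeny_irreducible_of_inputs`, verbatim.
[cite: Mazur1978, Cor. 4.4 (p. 145), with Cor. 4.3 and Prop. 3.1] -/
def cor44_valuation_j_le_one : Prop :=
  ∀ (W : WeierstrassCurve ℚ) [W.IsElliptic] (N : ℕ) [Fact N.Prime], (N = 11 ∨ 17 ≤ N) →
    (∃ C : AddSubgroup (geomTorsion W N),
      (∀ σ : absoluteGaloisGroup ℚ, ∀ P ∈ C, σ • P ∈ C) ∧ Nat.card C = N) →
    ∀ v : HeightOneSpectrum (𝓞 ℚ), (2 : 𝓞 ℚ) ∉ v.asIdeal → v.valuation ℚ W.j ≤ 1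

/-- **Mazur 1978, Prop. 5.1 — the classes of the exponent `k` — at a prime `N` of additive
reduction** (pp. 150–151: for `E/ℚ` with a rational `N`-isogeny, `N = 11` or `N ≥ 17`, the
isogeny character `r : Gal(ℚ̄/ℚ) → 𝔽_N^×` satisfies `r = α·χᵏ` with `α¹² = 1` (`α^{2t} = 1`,
`t = #μ`) and `k ≡ 0, 1, 1/2, 1/3` or `2/3 mod m`, `m = (N−1)/2` — so printed, p. 150: "the
integer `k` takes on only these values modulo `m`: `k ≡ 0`, or `1 mod m`, `k ≡ 1/2 mod m` (only
possible if `m ≢ 0 mod 2`), `k ≡ 1/3` or `2/3 mod m` (only possible if `m ≢ 0 mod 3`)", with the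
standing conventions of p. 149 "`N ≥ 5`, a prime number, `m = (N−1)/2`, `n` = numerator of
`(N−1)/12`, `t = m/n`" and Lemma 5.3 (p. 149: if `K = ℚ` "the order of `α` divides `2t` (which
divides `12`)"); an earlier aside of this docstring, «printed: mod `(N−1)/t`», was a misreading and
is withdrawn — the DECLARATION below uses `(N−1)/2`, as printed (ARM P reader r03 Q28
N-r03-Q28-2, page images `sheets/r03-texts/maz78-gdz/p_phys157.jpg` / `p_phys158.jpg` = pp. 149–150;
desk C2 ROUND 519; DD-120); proof via the Néron model over the ring of integers of a totally
ramified extension of `ℚ_N` of degree `e ∣ 12`, `e ≤ 6`, over which `E` acquires good reduction,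
and Raynaud's classification of finite flat group schemes of type `(p,…,p)` for `e < p − 1`,
Raynaud 1974, Cor. 3.4.4). Rendered in the
shape consumed by `mazur_isogeny_irreducible_of_inputs` (its hypothesis `hProp51`, verbatim): for a
Weierstrass model `W/ℚ`, a prime `N` with `N = 11 ∨ 17 ≤ N`, a nonzero `P ∈ E[N]` spanning a
stable line with character `r` (`σ•P = r(σ)·P`), `j` integral at the place above `N`
(potentially good reduction at `N`, supplied by Cor. 4.4) but NOT good reduction at `N`, and the
normal form of Lemma 5.2 / Lemma 5.3 (PROVED in the tree, `exists_forall_isogenyCharacter_eq_mul_pow`):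
`r = χ̄ᵏ⁰` on the inertia groups at `N` and `r = α·χ̄ᵏ⁰`, `α¹² = 1`, globally — THEN some `k` in
the five classes `k ≡ 0`, `k ≡ 1`, `2k ≡ 1`, `3k ≡ 1`, `3k ≡ 2 (mod (N−1)/2)` has `r = α'·χ̄ᵏ`,
`α'¹² = 1`. (At a prime `N` of GOOD reduction the classes `k₀ ≡ 0, 1` are the theorem
`modEq_zero_or_one_of_hasGoodReductionAtPrime`, Serre 1972 §1.11; hence the restriction to
`¬ HasGoodReductionAtPrime`.) `χ̄ = modNCyclotomicCharacter ℚ N`.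
[cite: Mazur1978, Prop. 5.1 and its proof (pp. 150–151), Lemma 5.2] -/
def prop51_exponent_classes_of_additive : Prop :=
  ∀ (W : WeierstrassCurve ℚ) [W.IsElliptic] (N : ℕ) [Fact N.Prime], (N = 11 ∨ 17 ≤ N) →
    ∀ {P : geomTorsion W N}, P ≠ 0 → ∀ {r : absoluteGaloisGroup ℚ →* (ZMod N)ˣ},
    (∀ σ : absoluteGaloisGroup ℚ, σ • P = ((r σ : (ZMod N)ˣ) : ZMod N).val • P) →
    (∀ v : HeightOneSpectrum (𝓞 ℚ), (N : 𝓞 ℚ) ∈ v.asIdeal → v.valuation ℚ W.j ≤ 1) →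
    ¬ W.HasGoodReductionAtPrime N →
    ∀ k₀ : ℕ,
    (∀ (v : HeightOneSpectrum (𝓞 ℚ)), (N : 𝓞 ℚ) ∈ v.asIdeal → ∀ 𝔓 ∈ v.primesAbove,
      ∀ τ ∈ 𝔓.inertia (absoluteGaloisGroup ℚ), r τ = modNCyclotomicCharacter ℚ N τ ^ k₀) →
    (∀ σ : absoluteGaloisGroup ℚ, ∃ b : (ZMod N)ˣ, b ^ 12 = 1 ∧
      r σ = b * modNCyclotomicCharacter ℚ N σ ^ k₀) →
    ∃ k : ℕ, (k ≡ 0 [MOD (N - 1) / 2] ∨ k ≡ 1 [MOD (N - 1) / 2] ∨ 2 * k ≡ 1 [MOD (N - 1) / 2] ∨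
        3 * k ≡ 1 [MOD (N - 1) / 2] ∨ 3 * k ≡ 2 [MOD (N - 1) / 2]) ∧
      ∀ σ : absoluteGaloisGroup ℚ, ∃ b : (ZMod N)ˣ, b ^ 12 = 1 ∧
        r σ = b * modNCyclotomicCharacter ℚ N σ ^ k

end Mazur1978

/-- **Mazur's Theorem 1 (`mazur_isogeny_irreducible`) from its two remaining printed inputs,
Cor. 4.4 and the classes of `k` in Prop. 5.1** — the fact split: the assembly is the tree's
`Mazur1978.mazur_isogeny_irreducible_of_inputs` (§7, proof of Thm. 7.1, pp. 154–155: stable line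
and isogeny character; Cor. 4.4 ⇒ `j` integral at the odd places; normal form `r = αχ̄ᵏ`; the
classes of `k`; the congruences of Cor. 6.1 at every odd `q ≠ p`; `mem_mazurPrimes_of_congruences`).
[cite: Mazur1978, Thm. 1 (pp. 129–130); §7 proof of Thm. 7.1 (pp. 154–155)] -/
theorem mazur_isogeny_irreducible_holds_of (h44 : Mazur1978.cor44_valuation_j_le_one)
    (h51 : Mazur1978.prop51_exponent_classes_of_additive) : mazur_isogeny_irreducible :=
  Mazur1978.mazur_isogeny_irreducible_of_inputs h44 h51

end Literature.NumberTheory.EllipticCurves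

end
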